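/-
Copyright: statement-level skeleton of a published paper (lit-balaban cell, Phase-2 proof seat p37 gen 109). No claims beyond
what the kernel checks below.
-/
import Mathlib
import Literature.MathematicalPhysics.QuantumFieldTheory.Balaban1983to89.B3GraphIso
import Literature.MathematicalPhysics.QuantumFieldTheory.Balaban1983to89.B3OnePIChainAmplitude
import Literature.MathematicalPhysics.QuantumFieldTheory.Balaban1983to89.B3GraphAmplitudeRules

/-!
# B3 — T. Bałaban, *(Higgs)₂,₃ quantum fields in a finite volume. III. Renormalization*, CMP **88** (1983) 411–445
[Balaban1983Higgs3], pp. 414–416, 419–420 [PDF 4–6, 9–10]: **ISOMORPHIC GRAPHS HAVE THE SAME EXPRESSION — the invariance of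
p26's evaluator E(G, Φ_ext, A_ext) (`B3GraphAmplitude.amp`, `B3GraphAmplitudeRules.graphAmp`) under p32's isomorphisms of graphs of
the model (`B3GraphIso.GraphIso`), and of p37's amputated two-point kernel of a dressed insertion (`B3OnePIChainAmplitude.Dressing.kernel`)
under `B3GraphIso.TwoLegGraphIso`**

statement-level skeleton of published theorems with citation tags; proofs where landed; nothing here is a claim about
the Yang–Mills mass gap

PDF held: `paper:balaban1983-higgs-2-3-quantum-fields-finite-volume` (journal page = PDF page + 410); pp. 414–416, 419–420 as read
for the files this one consumes (p26 `B3GraphAmplitude` ×2 renders p004/p005/p010; p32 `B3GraphIso` OCR pp. 415–416).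

CITATION HEADER (lean-in-tree rule).  lit-balaban TYPED SKELETON (HOME `run/shared/lean/pub/lit-balaban/`), PHASE 2, seat p37
gen 109 (unit `lit-balaban-p37`; TAKING (L), HOME/STATUS.md 2026-08-23T18:03:45Z, free-target protocol G.5-34(d)), row
**B3.Eq1.19-1.22** of `HOME/lit-balaban-r15/ROWS-B3.md` (fold owner r15, referee ref-4; this file is an OPTIONAL located member
of its (1.21) cell, zero head weight).  THE ITEM: p32's `B3GraphIso` HONEST SCOPE names it verbatim — *"no amplitude is attached
(invariance of p26's evaluator under isomorphism is not stated)"* — and p32 gen 44's `B3OnePIChainClasses` scope again: *"(1.21)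
for the series indexed by `UnglueableClass` itself — needs a dressing of the chosen representatives `rep` and the invariance of
`Dressing.kernel` under `TwoLegGraphIso`, neither of which is in the tree"* (seat INBOX 2026-08-23T16:39Z: *"free for whoever
wants it"*).  CONSUMES BY NAME: p18's model `B3Cor23Concrete.Graph` / `Leg`; p32's `B3GraphIso.GraphIso` (`toEquiv`, `kind_eq`,
`legMap`, `other_legMap`) and `TwoLegGraphIso` (`legMap_legIn`, `legMap_legOut`); p26's `B3GraphAmplitude.{Pairing, SLeg, VLeg,
OLeg, spartner, vpartner, sPairing, vPairing, SLine, VLine, ExtSLeg, ExtVLeg, Rules, OutPairing, vertexFactor, sLineFactor,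
vLineFactor, oLineFactor, prodExtV, amp}` (p360876 lineage) and `B3GraphAmplitudeRules.{ruleOfKind, rulesOf, extS, extO,
graphAmp}`; p37's `B3PairingLineCalculus.{lineK, pairK, lineProd, lineProd_rank_indep, Pairing.transportP, lineProd_transport}`
(p365622), `B3GraphGlueAmplitude.{FLeg, sleg, toLeg_sleg, sLeg_toLeg_injective, vLeg_toLeg_injective, spartner_def, vpartner_def}`
(p366933), `B3OnePIChainAmplitude.{sIn, sOut, extIn, extOut, Rest, Dressing,
Dressing.legAmp, Dressing.kernel}` (p368132).  Nothing re-declared; nothing is added to `B3GraphIso`'s side of the notion.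

THE PRINTED TEXT (verbatim).  p. 414 [PDF 4]: *"All the A′-legs are contracted, i.e. they are divided into pairs and each pair is
replaced by the corresponding propagator. Some φ′-legs are replaced by external scalar fields and the remaining are again divided
into pairs and each pair is replaced by a propagator … Of course the whole expression is multiplied by a proper combinatorial
factor connected with the number of ways given expression can be obtained from Gaussian integrals in (1.5)."*  p. 415 [PDF 5]:
*"Now a graph for us is a collection of internal lines, external legs, and vertices connected in the usual sense."*  p. 416
[PDF 6]: *"Σ^ε, Σ₁^ε, Σ₂^ε are given by amputated, one-particle-irreducible graphs of the expansion of G^ε."* (1.21).  p. 420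
[PDF 10]: *"Let us denote by E(G, {□(v)}_{v∈G}, Φ_ext, A_ext) the expression corresponding to graph G …"*.

KIND «(ours)» (G.5-54).  Print takes graphs *"in the usual sense"*, i.e. up to isomorphism, and attaches ONE expression E(G, ·)
to a graph; p18's carrier labels the vertices by `Fin nV` and the legs by slots, p26's evaluator is defined on the labelled
carrier, and p32's `GraphIso` is the identification.  That E(G, ·) does not depend on the labels — the content of this file — is
the (folklore) statement which makes print's "the expression corresponding to graph G" and the sum of (1.21) over (classes of)
1PI graphs meaningful on the model; print provenance is claimed only for the sentences quoted above, each declaration's cite tag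
locates the printed notion it serves.

WHAT IS TYPED / PROVED (definitions with bodies + theorems; no `Prop` fact, no `sorry`; standard axioms).
* `§1` THE LEG BIJECTIONS OF AN ISOMORPHISM, SPECIES BY SPECIES: `fleg_ext`, **`flegIso f σ hσ : FLeg f kG ≃ FLeg f kH`** (along a
  kind-preserving vertex bijection, slots re-indexed by `Fin.cast`), `flegIso_mk_cast`; for `e : GraphIso G H` the abbreviations
  **`isoS e : SLeg G.kind ≃ SLeg H.kind`**, **`isoV e`**, **`isoO e`**; `toLeg_isoS` / `toLeg_isoV` (= `e.legMap` on p18's legs);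
  **`spartner_isoS`** / **`vpartner_isoV`** (THE SCALAR AND VECTOR PAIRINGS ARE TRANSPORTED: `spartner H (isoS e x) =
  (spartner G x).map (isoS e)`); **`isoExtS e : ExtSLeg G ≃ ExtSLeg H`**, **`isoExtV e`**.
* `§2` PULLED-BACK DATA along `e` (everything p26's evaluator takes, read from `H` on `G`): **`pullRules e V`** (vertex `i` gets the
  rule of `e i`, slots re-indexed), **`pullPo e Po`** (the (1.18) output pairing, FILE K1's `transportP`; `pullPo_other`,
  `isoExtO e Po : (pullPo e Po).Ext ≃ Po.Ext`), **`pullKs e Ks`** / **`pullKv e Kv`** / **`pullKo e Po Ko`** (the line kernels: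
  FILE K1's `lineK ∘ pairK` read through the leg bijection — a line whose lower endpoint is the image of the upper endpoint gets
  the TRANSPOSED kernel, as p. 414's propagator entry read from the other end), `pullExtS` / `pullExtV` / `pullExtO` (external
  component functions relabelled) with `pullExtS_apply` / `pullExtV_apply` / `pullExtO_apply`.
* `§3` **`vertexFactor_pull`**, **`sLineFactor_pull`** / **`vLineFactor_pull`** / **`oLineFactor_pull`** (FILE K1:
  `lineProd_transport` + `lineProd_rank_indep` — the leg rank `Nat.pair (vertex, slot)` is NOT preserved by `e`, the flip-symmetry
  of pair kernels absorbs the change of representatives), and **`amp_iso`**: for external component functions `Φ'`, `A'`, `Ψ'` of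
  `G` that are those of `H` relabelled (`hΦ hA hΨ`, stated on index assignments),
  `amp (pullRules e V) bS bV bO (pullPo e Po) (pullKs e Ks) (pullKv e Kv) (pullKo e Po Ko) Φ' A' Ψ' = amp V bS bV bO Po Ks Kv Ko Φ A Ψ`;
  **`amp_iso_pull`** (the same with `pullExtS` / `pullExtV` / `pullExtO`).
* `§4` ON p26's CONCRETE EXPRESSION E(G, {□(v)}, Φ_ext, A_ext): **`pullRules_rulesOf`** (`pullRules e (rulesOf H M dm2 loc) =
  rulesOf G M (dm2 ∘ e) (loc ∘ e)`: a vertex keeps its catalogue rule (1.6)–(1.15), its counterterm label and its localization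
  under relabelling), `pullKs_const` / `pullKv_const` / `pullKo_const` (a SYMMETRIC kernel common to all lines pulls back to itself),
  **`graphAmp_iso`**, `extS_iso` / `prodExtV_iso` / `extO_iso` (product external fields relabelled), **`graphAmp_iso_prod`**.
* `§5` ON p37's DRESSED INSERTIONS: `isoS_sIn` / `isoS_sOut` (the channel legs correspond), `isoExtS_extIn` / `isoExtS_extOut`,
  **`isoRest e : Rest T ≃ Rest T'`**, **`pullDressing e D`** (a dressing of `T'` read on `T`), **`legAmp_pull`**, and
  **`kernel_pull : (pullDressing e D).kernel bS bV bO = D.kernel bS bV bO`** — THE AMPUTATED TWO-POINT KERNEL OF (1.21) IS AN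
  ISOMORPHISM INVARIANT of dressed insertions (for transported dressings).
HONEST SCOPE.  (a) Index form only, as FILEs 1/K1–K4: rules, pairings, kernels and external component functions are PARAMETERS and
are transported, nothing about them is used; in particular a dressing is extra structure on a graph (the (1.18) output pairing is
not recorded by p18's `Graph`), and the invariance is for the TRANSPORTED dressing — that the physical dressing of a graph
(catalogue rules, one propagator for every line, the (1.18) pairing read off the picture) is transported to the physical dressing
is proved here for the rules (`pullRules_rulesOf`) and for line-independent symmetric kernels (`pull*_const`), the rest is the
instantiating file's business.  (b) No quotient is formed here: composing `kernel_pull` with p32's `B3OnePIChainClasses.classEquiv`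
/ `rep` / `repIso` (not yet in the tree at the time of writing) to index (1.21) by isomorphism classes is a successor file.
(c) No symmetry factors (p. 414's *"proper combinatorial factor"*), no enumeration, nothing analytic.  Definitions with bodies +
theorems; no `Prop` fact, no `sorry`; standard axioms.  Unit `lit-balaban-p37` gen 109 (literature-prover-lit-balaban-p37-g109-0),
HOME `run/shared/lean/pub/lit-balaban/`, 2026-08-23.
-/

open Finset
open scoped BigOperators

namespace Literature.MathematicalPhysics.QuantumFieldTheory.Balaban1983to89.B3GraphIsoAmplitude

open B3Prop1 B3Cor23Concrete B3GraphGlueLegs B3GraphAmplitude B3PairingLineCalculus B3GraphGlueAmplitude B3GraphIso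
  B3OnePIChainGlue B3OnePIChainAmplitude B3GraphAmplitudeRules

noncomputable section

/-! ## §1 The leg bijections of an isomorphism, species by species -/

section FLegIso

variable {n n' : ℕ} {kG : Fin n → VertexKind} {kH : Fin n' → VertexKind} (f : VertexKind → ℕ)

/-- kernel («(ours)», plumbing): two legs of one fibre-size function are equal iff they sit at the same vertex and their slots
have the same value. [cite: Balaban1983Higgs3, (1.17) p.415] -/
theorem fleg_ext {x y : FLeg f kG} (h₁ : x.1 = y.1) (h₂ : (x.2 : ℕ) = y.2) : x = y := by
  obtain ⟨v, s⟩ := x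
  obtain ⟨w, t⟩ := y
  dsimp only at h₁ h₂
  subst h₁
  have hst : s = t := Fin.ext h₂
  subst hst
  rfl

variable (σ : Fin n ≃ Fin n') (hσ : ∀ v, kH (σ v) = kG v)

/-- **The bijection of the legs of one fibre-size function `f` induced by a kind-preserving bijection of the vertices** («(ours)»;
`f = scalarLegs`: the φ′-legs, `f = vectorLegs`: the A′-legs, `f = outSlots`: the output slots of (1.13)–(1.15)): the leg in slot
`s` of `v` goes to the leg in slot `s` of `σ v`. [cite: Balaban1983Higgs3, (1.17) p.415] -/
def flegIso : FLeg f kG ≃ FLeg f kH where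
  toFun x := ⟨σ x.1, Fin.cast (congrArg f (hσ x.1)).symm x.2⟩
  invFun y := ⟨σ.symm y.1,
    Fin.cast (congrArg f ((hσ (σ.symm y.1)).symm.trans (congrArg kH (σ.apply_symm_apply y.1)))).symm y.2⟩
  left_inv x := fleg_ext f (σ.symm_apply_apply x.1) (by simp)
  right_inv y := fleg_ext f (σ.apply_symm_apply y.1) (by simp)

/-- kernel: the vertex of the image leg. [cite: Balaban1983Higgs3, (1.17) p.415] -/
@[simp] theorem flegIso_fst (x : FLeg f kG) : (flegIso f σ hσ x).1 = σ x.1 := rfl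

/-- kernel: the slot of the image leg has the same value. [cite: Balaban1983Higgs3, (1.17) p.415] -/
@[simp] theorem flegIso_snd_val (x : FLeg f kG) : ((flegIso f σ hσ x).2 : ℕ) = x.2 := rfl

/-- kernel: the vertex of the preimage leg. [cite: Balaban1983Higgs3, (1.17) p.415] -/
@[simp] theorem flegIso_symm_fst (y : FLeg f kH) : ((flegIso f σ hσ).symm y).1 = σ.symm y.1 := rfl

/-- kernel: the slot of the preimage leg has the same value. [cite: Balaban1983Higgs3, (1.17) p.415] -/
@[simp] theorem flegIso_symm_snd_val (y : FLeg f kH) : (((flegIso f σ hσ).symm y).2 : ℕ) = y.2 := rfl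

/-- kernel: the image of the leg of `v` in the re-indexed slot `s` is the leg of `σ v` in slot `s` (the casts of `pullRules`
cancel against the leg bijection). [cite: Balaban1983Higgs3, (1.17) p.415] -/
@[simp] theorem flegIso_mk_cast (i : Fin n) (j : Fin (f (kH (σ i)))) :
    flegIso f σ hσ ⟨i, Fin.cast (congrArg f (hσ i)) j⟩ = ⟨σ i, j⟩ :=
  fleg_ext f rfl rfl

end FLegIso

section Species

variable {nbar : ℕ} {G H : Graph nbar}

/-- **The bijection of the φ′-legs induced by an isomorphism** (p26's `SLeg`). [cite: Balaban1983Higgs3, (1.17) p.415] -/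
abbrev isoS (e : GraphIso G H) : SLeg G.kind ≃ SLeg H.kind := flegIso VertexKind.scalarLegs e.toEquiv e.kind_eq

/-- **The bijection of the A′-legs induced by an isomorphism** (p26's `VLeg`). [cite: Balaban1983Higgs3, (1.17) p.415] -/
abbrev isoV (e : GraphIso G H) : VLeg G.kind ≃ VLeg H.kind := flegIso VertexKind.vectorLegs e.toEquiv e.kind_eq

/-- **The bijection of the output slots of the averaging vertices (1.13)–(1.15) induced by an isomorphism** (p26's `OLeg`; the
number of output slots depends on the kind only). [cite: Balaban1983Higgs3, (1.18) p.415] -/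
abbrev isoO (e : GraphIso G H) : OLeg G.kind ≃ OLeg H.kind := flegIso outSlots e.toEquiv e.kind_eq

/-- kernel: on φ′-legs the species bijection IS p32's leg map `e.legMap` (same vertex image, same slot).
[cite: Balaban1983Higgs3, (1.17) p.415] -/
theorem toLeg_isoS (e : GraphIso G H) (x : SLeg G.kind) : (isoS e x).toLeg = e.legMap x.toLeg := rfl

/-- kernel: on A′-legs the species bijection IS p32's leg map. [cite: Balaban1983Higgs3, (1.17) p.415] -/
theorem toLeg_isoV (e : GraphIso G H) (x : VLeg G.kind) : (isoV e x).toLeg = e.legMap x.toLeg := rfl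

/-- **THE SCALAR PAIRING IS TRANSPORTED by an isomorphism**: the partner of the image φ′-leg is the image of the partner —
internal scalar lines go to internal scalar lines, external φ′-legs to external φ′-legs. [cite: Balaban1983Higgs3, p.415] -/
theorem spartner_isoS (e : GraphIso G H) (x : SLeg G.kind) : spartner H (isoS e x) = (spartner G x).map (isoS e) := by
  rw [spartner_def, spartner_def, toLeg_isoS, e.other_legMap]
  rcases h : G.other x.toLeg with _ | y
  · rfl
  · obtain ⟨i', j', rfl, -⟩ := G.other_scalar h
    have h1 : toSLeg? (some (⟨i', Sum.inl j'⟩ : Leg G.kind)) = some (⟨i', j'⟩ : SLeg G.kind) :=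
      (toSLeg?_eq_some_iff _ _).2 rfl
    have h2 : toSLeg? (some (e.legMap (⟨i', Sum.inl j'⟩ : Leg G.kind))) = some (isoS e ⟨i', j'⟩) :=
      (toSLeg?_eq_some_iff _ _).2 (by rw [toLeg_isoS]; rfl)
    rw [Option.map_some, h2, h1, Option.map_some]

/-- **THE VECTOR PAIRING IS TRANSPORTED by an isomorphism.** [cite: Balaban1983Higgs3, p.415] -/
theorem vpartner_isoV (e : GraphIso G H) (x : VLeg G.kind) : vpartner H (isoV e x) = (vpartner G x).map (isoV e) := by
  rw [vpartner_def, vpartner_def, toLeg_isoV, e.other_legMap]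
  rcases h : G.other x.toLeg with _ | y
  · rfl
  · obtain ⟨i', j', rfl, -⟩ := G.other_vector h
    have h1 : toVLeg? (some (⟨i', Sum.inr j'⟩ : Leg G.kind)) = some (⟨i', j'⟩ : VLeg G.kind) :=
      (toVLeg?_eq_some_iff _ _).2 rfl
    have h2 : toVLeg? (some (e.legMap (⟨i', Sum.inr j'⟩ : Leg G.kind))) = some (isoV e ⟨i', j'⟩) :=
      (toVLeg?_eq_some_iff _ _).2 (by rw [toLeg_isoV]; rfl)
    rw [Option.map_some, h2, h1, Option.map_some]

/-- kernel: `spartner_isoS` in the form FILE K1's transport lemmas take (`(sPairing _).other`). [cite: Balaban1983Higgs3, p.415] -/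
theorem sPairing_other_isoS (e : GraphIso G H) (x : SLeg G.kind) :
    (sPairing H).other (isoS e x) = ((sPairing G).other x).map (isoS e) :=
  spartner_isoS e x

/-- kernel: `vpartner_isoV` in FILE K1's form. [cite: Balaban1983Higgs3, p.415] -/
theorem vPairing_other_isoV (e : GraphIso G H) (x : VLeg G.kind) :
    (vPairing H).other (isoV e x) = ((vPairing G).other x).map (isoV e) :=
  vpartner_isoV e x

/-- **The external φ′-legs of isomorphic graphs correspond** (the legs *"replaced by external scalar fields"*, p. 414).
[cite: Balaban1983Higgs3, p.414] [cite: Balaban1983Higgs3, p.415] -/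
def isoExtS (e : GraphIso G H) : ExtSLeg G ≃ ExtSLeg H :=
  (isoS e).subtypeEquiv fun x => by
    change spartner G x = none ↔ spartner H (isoS e x) = none
    rw [spartner_isoS]
    simp

/-- **The external A′-legs of isomorphic graphs correspond.** [cite: Balaban1983Higgs3, p.414] [cite: Balaban1983Higgs3, p.415] -/
def isoExtV (e : GraphIso G H) : ExtVLeg G ≃ ExtVLeg H :=
  (isoV e).subtypeEquiv fun x => by
    change vpartner G x = none ↔ vpartner H (isoV e x) = none
    rw [vpartner_isoV]
    simp

/-- kernel: the underlying φ′-leg of the image external leg. [cite: Balaban1983Higgs3, p.415] -/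
@[simp] theorem isoExtS_apply_val (e : GraphIso G H) (x : ExtSLeg G) : (isoExtS e x).1 = isoS e x.1 := rfl

/-- kernel: the underlying φ′-leg of the preimage external leg. [cite: Balaban1983Higgs3, p.415] -/
@[simp] theorem isoExtS_symm_apply_val (e : GraphIso G H) (y : ExtSLeg H) : ((isoExtS e).symm y).1 = (isoS e).symm y.1 := rfl

/-- kernel: the underlying A′-leg of the image external leg. [cite: Balaban1983Higgs3, p.415] -/
@[simp] theorem isoExtV_apply_val (e : GraphIso G H) (x : ExtVLeg G) : (isoExtV e x).1 = isoV e x.1 := rfl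

/-- kernel: the underlying A′-leg of the preimage external leg. [cite: Balaban1983Higgs3, p.415] -/
@[simp] theorem isoExtV_symm_apply_val (e : GraphIso G H) (y : ExtVLeg H) : ((isoExtV e).symm y).1 = (isoV e).symm y.1 := rfl

end Species

/-! ## §2 The data of the evaluator read through an isomorphism -/

section Pull

variable {nbar : ℕ} {G H : Graph nbar} {SF VF OF : Type*} {IS IV IO : Type*}

/-- **The vertex rules read through an isomorphism**: vertex `i` of `G` gets the rule of the vertex `e i` of `H` (same kind, by
`e.kind_eq`; the leg slots re-indexed along that equality). [cite: Balaban1983Higgs3, (1.6)–(1.15) pp.413–414]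
[cite: Balaban1983Higgs3, p.420] -/
def pullRules (e : GraphIso G H) (V : Rules H SF VF OF) : Rules G SF VF OF := fun i fs fv fo =>
  V (e.toEquiv i) (fun j => fs (Fin.cast (congrArg VertexKind.scalarLegs (e.kind_eq i)) j))
    (fun j => fv (Fin.cast (congrArg VertexKind.vectorLegs (e.kind_eq i)) j))
    (fun j => fo (Fin.cast (congrArg outSlots (e.kind_eq i)) j))

/-- **The (1.18) output pairing read through an isomorphism** (FILE K1's transport of a pairing along the bijection of the output
slots). [cite: Balaban1983Higgs3, (1.18) p.415] -/
def pullPo (e : GraphIso G H) (Po : OutPairing H) : OutPairing G :=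
  Po.transportP (isoO e).symm

/-- kernel: the pulled-back output pairing is transported back to `Po` by the slot bijection (FILE K1's hypothesis shape).
[cite: Balaban1983Higgs3, (1.18) p.415] -/
theorem pullPo_other (e : GraphIso G H) (Po : OutPairing H) (x : OLeg G.kind) :
    Po.other (isoO e x) = ((pullPo e Po).other x).map (isoO e) := by
  have h := transportP_other_apply Po (isoO e).symm (isoO e x)
  rw [Equiv.symm_apply_apply] at h
  change (pullPo e Po).other x = _ at h
  rw [h, Option.map_map, Equiv.self_comp_symm]
  simp

/-- **The unpaired outputs of isomorphic graphs (with transported (1.18) pairings) correspond.** [cite: Balaban1983Higgs3, (1.18) p.415] -/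
def isoExtO (e : GraphIso G H) (Po : OutPairing H) : (pullPo e Po).Ext ≃ Po.Ext :=
  (isoO e).subtypeEquiv fun x => by
    rw [pullPo_other]
    simp

/-- kernel: the underlying slot of the image unpaired output. [cite: Balaban1983Higgs3, (1.18) p.415] -/
@[simp] theorem isoExtO_apply_val (e : GraphIso G H) (Po : OutPairing H) (x : (pullPo e Po).Ext) :
    (isoExtO e Po x).1 = isoO e x.1 := rfl

/-- kernel: the underlying slot of the preimage unpaired output. [cite: Balaban1983Higgs3, (1.18) p.415] -/
@[simp] theorem isoExtO_symm_apply_val (e : GraphIso G H) (Po : OutPairing H) (y : Po.Ext) :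
    ((isoExtO e Po).symm y).1 = (isoO e).symm y.1 := rfl

/-- **The scalar line kernels read through an isomorphism** (one kernel per line of `G`, in FILE 1's shape): the line of `G`
represented by its lower endpoint `x` carries the kernel of its image line in `H` — read from `e x`, i.e. the image line's kernel if
`e x` is its lower endpoint and the transposed kernel if `e x` is the upper endpoint (p. 414: the propagator entry read from the
other end). [cite: Balaban1983Higgs3, p.414] -/
def pullKs (e : GraphIso G H) (Ks : SLine H → IS → IS → ℝ) : SLine G → IS → IS → ℝ :=
  lineK (sPairing G) sRank fun x y => pairK (sPairing H) sRank Ks (isoS e x) (isoS e y)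

/-- **The vector line kernels read through an isomorphism.** [cite: Balaban1983Higgs3, p.414] -/
def pullKv (e : GraphIso G H) (Kv : VLine H → IV → IV → ℝ) : VLine G → IV → IV → ℝ :=
  lineK (vPairing G) vRank fun x y => pairK (vPairing H) vRank Kv (isoV e x) (isoV e y)

/-- **The (1.18) output pair kernels read through an isomorphism.** [cite: Balaban1983Higgs3, (1.18) p.415] -/
def pullKo (e : GraphIso G H) (Po : OutPairing H) (Ko : Po.Line oRank → IO → IO → ℝ) :
    (pullPo e Po).Line oRank → IO → IO → ℝ :=
  lineK (pullPo e Po) oRank fun x y => pairK Po oRank Ko (isoO e x) (isoO e y)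

/-- **The external scalar component function read through an isomorphism** (p. 419's joint component functions *"of many
variables instead of a product"*, their arguments relabelled by `isoExtS`). [cite: Balaban1983Higgs3, p.419] -/
def pullExtS (e : GraphIso G H) (Φ : (ExtSLeg H → IS) → ℝ) : (ExtSLeg G → IS) → ℝ :=
  fun γ => Φ fun ℓ => γ ((isoExtS e).symm ℓ)

/-- **The external vector component function read through an isomorphism.** [cite: Balaban1983Higgs3, p.419] -/
def pullExtV (e : GraphIso G H) (A : (ExtVLeg H → IV) → ℝ) : (ExtVLeg G → IV) → ℝ :=
  fun ζ => A fun ℓ => ζ ((isoExtV e).symm ℓ)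

/-- **The external output component function (1.12) read through an isomorphism.** [cite: Balaban1983Higgs3, (1.18) p.415] -/
def pullExtO (e : GraphIso G H) (Po : OutPairing H) (Ψ : (Po.Ext → IO) → ℝ) : ((pullPo e Po).Ext → IO) → ℝ :=
  fun ξ => Ψ fun ℓ => ξ ((isoExtO e Po).symm ℓ)

/-- kernel: at an index assignment of `G` read from one of `H`, the pulled-back scalar component function takes the value of the
original. [cite: Balaban1983Higgs3, p.419] -/
theorem pullExtS_apply (e : GraphIso G H) (Φ : (ExtSLeg H → IS) → ℝ) (α : SLeg H.kind → IS) :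
    pullExtS e Φ (fun ℓ => α (isoS e ℓ.1)) = Φ (fun ℓ => α ℓ.1) := by
  unfold pullExtS
  congr 1
  funext ℓ
  simp

/-- kernel: the same for the vector component function. [cite: Balaban1983Higgs3, p.419] -/
theorem pullExtV_apply (e : GraphIso G H) (A : (ExtVLeg H → IV) → ℝ) (β : VLeg H.kind → IV) :
    pullExtV e A (fun ℓ => β (isoV e ℓ.1)) = A (fun ℓ => β ℓ.1) := by
  unfold pullExtV
  congr 1
  funext ℓ
  simp

/-- kernel: the same for the output component function. [cite: Balaban1983Higgs3, (1.18) p.415] -/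
theorem pullExtO_apply (e : GraphIso G H) (Po : OutPairing H) (Ψ : (Po.Ext → IO) → ℝ) (ο : OLeg H.kind → IO) :
    pullExtO e Po Ψ (fun ℓ => ο (isoO e ℓ.1)) = Ψ (fun ℓ => ο ℓ.1) := by
  unfold pullExtO
  congr 1
  funext ℓ
  simp

end Pull

/-! ## §3 Invariance of the evaluator -/

section Invariance

variable {nbar : ℕ} {G H : Graph nbar} {SF VF OF : Type*} {IS IV IO : Type*}

/-- **The vertex factor is invariant**: at assignments read through the leg bijections, the pulled-back rules give the vertex
factor of `H` (the product over the vertices re-indexed along `e`; the slot casts cancel). [cite: Balaban1983Higgs3, p.414] -/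
theorem vertexFactor_pull (e : GraphIso G H) (V : Rules H SF VF OF) (bS : IS → SF) (bV : IV → VF) (bO : IO → OF)
    (α : SLeg H.kind → IS) (β : VLeg H.kind → IV) (ο : OLeg H.kind → IO) :
    vertexFactor (pullRules e V) bS bV bO (fun ℓ => α (isoS e ℓ)) (fun ℓ => β (isoV e ℓ)) (fun ℓ => ο (isoO e ℓ)) =
      vertexFactor V bS bV bO α β ο := by
  unfold vertexFactor
  refine Fintype.prod_equiv e.toEquiv _ _ fun i => ?_
  simp only [pullRules, flegIso_mk_cast]

/-- **The scalar line factor is invariant**: *"each pair is replaced by the corresponding propagator"* does not see the labels —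
FILE K1's transport of the line product along the leg bijection (pairing transported: `spartner_isoS`), followed by its
independence of the rank that picks the lines' representatives (the rank `Nat.pair (vertex, slot)` is not preserved by `e`; the
pair kernel is flip-symmetric). [cite: Balaban1983Higgs3, p.414] -/
theorem sLineFactor_pull (e : GraphIso G H) (Ks : SLine H → IS → IS → ℝ) (α : SLeg H.kind → IS) :
    sLineFactor (G := G) (pullKs e Ks) (fun ℓ => α (isoS e ℓ)) = sLineFactor Ks α := by
  have hr : Function.Injective (fun z : SLeg H.kind => sRank ((isoS e).symm z)) :=
    sRank_injective.comp (isoS e).symm.injective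
  calc sLineFactor (G := G) (pullKs e Ks) (fun ℓ => α (isoS e ℓ))
      = lineProd (sPairing G) sRank (fun x y => pairK (sPairing H) sRank Ks (isoS e x) (isoS e y)) (α ∘ isoS e) := rfl
    _ = lineProd (sPairing H) (fun z => sRank ((isoS e).symm z)) (pairK (sPairing H) sRank Ks) α :=
        (lineProd_transport (sPairing_other_isoS e) (fun x => by simp) _ _).symm
    _ = lineProd (sPairing H) sRank (pairK (sPairing H) sRank Ks) α :=
        lineProd_rank_indep _ hr sRank_injective (pairK_flipSymm _ _ sRank_injective Ks) α
    _ = sLineFactor Ks α := (prod_line_eq_lineProd_pairK (sPairing H) sRank Ks α).symm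

/-- **The vector line factor is invariant.** [cite: Balaban1983Higgs3, p.414] -/
theorem vLineFactor_pull (e : GraphIso G H) (Kv : VLine H → IV → IV → ℝ) (β : VLeg H.kind → IV) :
    vLineFactor (G := G) (pullKv e Kv) (fun ℓ => β (isoV e ℓ)) = vLineFactor Kv β := by
  have hr : Function.Injective (fun z : VLeg H.kind => vRank ((isoV e).symm z)) :=
    vRank_injective.comp (isoV e).symm.injective
  calc vLineFactor (G := G) (pullKv e Kv) (fun ℓ => β (isoV e ℓ))
      = lineProd (vPairing G) vRank (fun x y => pairK (vPairing H) vRank Kv (isoV e x) (isoV e y)) (β ∘ isoV e) := rfl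
    _ = lineProd (vPairing H) (fun z => vRank ((isoV e).symm z)) (pairK (vPairing H) vRank Kv) β :=
        (lineProd_transport (vPairing_other_isoV e) (fun x => by simp) _ _).symm
    _ = lineProd (vPairing H) vRank (pairK (vPairing H) vRank Kv) β :=
        lineProd_rank_indep _ hr vRank_injective (pairK_flipSymm _ _ vRank_injective Kv) β
    _ = vLineFactor Kv β := (prod_line_eq_lineProd_pairK (vPairing H) vRank Kv β).symm

/-- **The (1.18) output pair factor is invariant** (for the transported output pairing). [cite: Balaban1983Higgs3, (1.18) p.415] -/
theorem oLineFactor_pull (e : GraphIso G H) (Po : OutPairing H) (Ko : Po.Line oRank → IO → IO → ℝ) (ο : OLeg H.kind → IO) :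
    oLineFactor (G := G) (pullPo e Po) (pullKo e Po Ko) (fun ℓ => ο (isoO e ℓ)) = oLineFactor Po Ko ο := by
  have hr : Function.Injective (fun z : OLeg H.kind => oRank ((isoO e).symm z)) :=
    oRank_injective.comp (isoO e).symm.injective
  calc oLineFactor (G := G) (pullPo e Po) (pullKo e Po Ko) (fun ℓ => ο (isoO e ℓ))
      = lineProd (pullPo e Po) oRank (fun x y => pairK Po oRank Ko (isoO e x) (isoO e y)) (ο ∘ isoO e) := rfl
    _ = lineProd Po (fun z => oRank ((isoO e).symm z)) (pairK Po oRank Ko) ο :=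
        (lineProd_transport (pullPo_other e Po) (fun x => by simp) _ _).symm
    _ = lineProd Po oRank (pairK Po oRank Ko) ο :=
        lineProd_rank_indep _ hr oRank_injective (pairK_flipSymm _ _ oRank_injective Ko) ο
    _ = oLineFactor Po Ko ο := (prod_line_eq_lineProd_pairK Po oRank Ko ο).symm

variable [Fintype IS] [Fintype IV] [Fintype IO]

/-- kernel: a sum over the index assignments of one leg type is the sum over the assignments of an equivalent leg type, read
through the equivalence. [folklore] -/
private theorem sum_arrow_equiv {L L' I : Type*} [Fintype L] [DecidableEq L] [Fintype L'] [DecidableEq L'] [Fintype I]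
    (ε : L ≃ L') (F : (L → I) → ℝ) : ∑ α : L → I, F α = ∑ α' : L' → I, F (fun ℓ => α' (ε ℓ)) :=
  Fintype.sum_equiv (ε.arrowCongr (Equiv.refl I)) _ _ fun α => by
    congr 1
    funext ℓ
    simp [Equiv.arrowCongr_apply]

/-- **ISOMORPHIC GRAPHS HAVE THE SAME EXPRESSION E(G, Φ_ext, A_ext)** (p. 415: graphs *"in the usual sense"*; p. 420: *"the
expression corresponding to graph G"*): for an isomorphism `e : G ≅ H` of graphs of the model, p26's evaluator of `G` with the
vertex rules, the (1.18) output pairing and the line kernels of `H` read through `e` (`pullRules`, `pullPo`, `pullKs`, `pullKv`,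
`pullKo`) and with external component functions `Φ'`, `A'`, `Ψ'` that are those of `H` relabelled along the correspondence of the
external legs (`hΦ`, `hA`, `hΨ`: stated on whole index assignments) EQUALS the evaluator of `H` — the sums over index assignments,
the vertex factors and the line factors are re-indexed along the leg bijections of `e`. [cite: Balaban1983Higgs3, p.420]
[cite: Balaban1983Higgs3, p.414] [cite: Balaban1983Higgs3, p.415] -/
theorem amp_iso (e : GraphIso G H) (V : Rules H SF VF OF) (bS : IS → SF) (bV : IV → VF) (bO : IO → OF) (Po : OutPairing H)
    (Ks : SLine H → IS → IS → ℝ) (Kv : VLine H → IV → IV → ℝ) (Ko : Po.Line oRank → IO → IO → ℝ)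
    (Φ : (ExtSLeg H → IS) → ℝ) (A : (ExtVLeg H → IV) → ℝ) (Ψ : (Po.Ext → IO) → ℝ)
    (Φ' : (ExtSLeg G → IS) → ℝ) (A' : (ExtVLeg G → IV) → ℝ) (Ψ' : ((pullPo e Po).Ext → IO) → ℝ)
    (hΦ : ∀ α : SLeg H.kind → IS, Φ' (fun ℓ => α (isoS e ℓ.1)) = Φ (fun ℓ => α ℓ.1))
    (hA : ∀ β : VLeg H.kind → IV, A' (fun ℓ => β (isoV e ℓ.1)) = A (fun ℓ => β ℓ.1))
    (hΨ : ∀ ο : OLeg H.kind → IO, Ψ' (fun ℓ => ο (isoO e ℓ.1)) = Ψ (fun ℓ => ο ℓ.1)) :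
    amp (pullRules e V) bS bV bO (pullPo e Po) (pullKs e Ks) (pullKv e Kv) (pullKo e Po Ko) Φ' A' Ψ' =
      amp V bS bV bO Po Ks Kv Ko Φ A Ψ := by
  unfold amp
  rw [sum_arrow_equiv (isoS e)]
  refine Finset.sum_congr rfl fun α _ => ?_
  rw [sum_arrow_equiv (isoV e)]
  refine Finset.sum_congr rfl fun β _ => ?_
  rw [sum_arrow_equiv (isoO e)]
  refine Finset.sum_congr rfl fun ο _ => ?_
  try dsimp only
  rw [vertexFactor_pull, sLineFactor_pull, vLineFactor_pull, oLineFactor_pull, hΦ, hA, hΨ]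

/-- **ISOMORPHIC GRAPHS HAVE THE SAME EXPRESSION, with ALL data read through the isomorphism** (external component functions
`pullExtS`, `pullExtV`, `pullExtO`). [cite: Balaban1983Higgs3, p.420] [cite: Balaban1983Higgs3, p.414] -/
theorem amp_iso_pull (e : GraphIso G H) (V : Rules H SF VF OF) (bS : IS → SF) (bV : IV → VF) (bO : IO → OF)
    (Po : OutPairing H) (Ks : SLine H → IS → IS → ℝ) (Kv : VLine H → IV → IV → ℝ) (Ko : Po.Line oRank → IO → IO → ℝ)
    (Φ : (ExtSLeg H → IS) → ℝ) (A : (ExtVLeg H → IV) → ℝ) (Ψ : (Po.Ext → IO) → ℝ) :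
    amp (pullRules e V) bS bV bO (pullPo e Po) (pullKs e Ks) (pullKv e Kv) (pullKo e Po Ko) (pullExtS e Φ) (pullExtV e A)
        (pullExtO e Po Ψ) = amp V bS bV bO Po Ks Kv Ko Φ A Ψ :=
  amp_iso e V bS bV bO Po Ks Kv Ko Φ A Ψ _ _ _ (pullExtS_apply e Φ) (pullExtV_apply e A) (pullExtO_apply e Po Ψ)

end Invariance

/-! ## §4 On the concrete expression E(G, {□(v)}, Φ_ext, A_ext) of the (Higgs)₂,₃ rules -/

section Concrete

variable {P : HiggsLattice.Params} {N k : ℕ}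
variable {nbar : ℕ} {G H : Graph nbar}

/-- **A VERTEX KEEPS ITS FEYNMAN RULE UNDER RELABELLING**: the catalogue rules (1.6)–(1.15) of `H` with counterterm labels `δm_i²`
and localizations `{□(v)}`, read through an isomorphism `e : G ≅ H`, ARE the catalogue rules of `G` with the labels and the
localizations read through `e` (vertex `i` of `G` has the kind of `e i`). [cite: Balaban1983Higgs3, (1.6)–(1.15) pp.413–414]
[cite: Balaban1983Higgs3, p.420] -/
theorem pullRules_rulesOf (e : GraphIso G H) (M : Model P N k) (dm2 : Fin H.nV → HiggsLattice.Site P 0 → ℝ)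
    (loc : Fin H.nV → Loc P k) :
    pullRules e (rulesOf H M dm2 loc) = rulesOf G M (fun i => dm2 (e.toEquiv i)) (fun i => loc (e.toEquiv i)) := by
  funext i fs fv fo
  simp only [pullRules, rulesOf]
  -- the slot re-indexing along `H.kind (e i) = G.kind i` (the `subst` step of FILE K4's `ruleOfKind_cast`, inlined so that this
  -- file does not depend on the gluing files)
  have hc : ∀ (κ' : VertexKind) (h : κ' = G.kind i),
      ruleOfKind k M (dm2 (e.toEquiv i)) (loc (e.toEquiv i)) κ'
          (fun j => fs (Fin.cast (congrArg VertexKind.scalarLegs h) j))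
          (fun j => fv (Fin.cast (congrArg VertexKind.vectorLegs h) j))
          (fun j => fo (Fin.cast (congrArg outSlots h) j)) =
        ruleOfKind k M (dm2 (e.toEquiv i)) (loc (e.toEquiv i)) (G.kind i) fs fv fo := by
    intro κ' h
    subst h
    rfl
  exact hc _ (e.kind_eq i)

variable {IS IV IO : Type*}

/-- **A SYMMETRIC KERNEL COMMON TO ALL SCALAR LINES PULLS BACK TO ITSELF** (the physical case: every scalar line of (1.21) carries
the same covariance `C`, `C(p,q) = C(q,p)`; in (2.7) per scale): reading it from either endpoint gives `C`.
[cite: Balaban1983Higgs3, p.414] [cite: Balaban1983Higgs3, (1.21) p.416] -/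
theorem pullKs_const (e : GraphIso G H) (C : IS → IS → ℝ) (hC : ∀ p q, C p q = C q p) :
    pullKs e (fun _ : SLine H => C) = fun _ : SLine G => C := by
  funext l p q
  simp only [pullKs, lineK, pairK]
  by_cases h : (sPairing H).isLower sRank (isoS e l.1) = true
  · rw [dif_pos h]
  · rw [dif_neg h]
    by_cases h' : (sPairing H).isLower sRank (isoS e ((sPairing G).mate l.1)) = true
    · rw [dif_pos h', hC]
    · exfalso
      have hl : (sPairing G).other l.1 = some ((sPairing G).mate l.1) := other_eq_some_mate _ l.2
      have hH : (sPairing H).other (isoS e l.1) = some (isoS e ((sPairing G).mate l.1)) := by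
        rw [sPairing_other_isoS, hl, Option.map_some]
      rcases (sPairing H).lower_xor sRank sRank_injective hH with ⟨h1, -⟩ | ⟨-, h2⟩
      · exact h h1
      · exact h' h2

/-- **A symmetric kernel common to all vector lines pulls back to itself.** [cite: Balaban1983Higgs3, p.414] -/
theorem pullKv_const (e : GraphIso G H) (C : IV → IV → ℝ) (hC : ∀ p q, C p q = C q p) :
    pullKv e (fun _ : VLine H => C) = fun _ : VLine G => C := by
  funext l p q
  simp only [pullKv, lineK, pairK]
  by_cases h : (vPairing H).isLower vRank (isoV e l.1) = true
  · rw [dif_pos h]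
  · rw [dif_neg h]
    by_cases h' : (vPairing H).isLower vRank (isoV e ((vPairing G).mate l.1)) = true
    · rw [dif_pos h', hC]
    · exfalso
      have hl : (vPairing G).other l.1 = some ((vPairing G).mate l.1) := other_eq_some_mate _ l.2
      have hH : (vPairing H).other (isoV e l.1) = some (isoV e ((vPairing G).mate l.1)) := by
        rw [vPairing_other_isoV, hl, Option.map_some]
      rcases (vPairing H).lower_xor vRank vRank_injective hH with ⟨h1, -⟩ | ⟨-, h2⟩
      · exact h h1
      · exact h' h2

/-- **A symmetric kernel common to all (1.18) output pairs pulls back to itself** (the physical case: `−a_k·[y = y′]·δ_{ab}`).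
[cite: Balaban1983Higgs3, (1.18) p.415] -/
theorem pullKo_const (e : GraphIso G H) (Po : OutPairing H) (C : IO → IO → ℝ) (hC : ∀ p q, C p q = C q p) :
    pullKo e Po (fun _ : Po.Line oRank => C) = fun _ : (pullPo e Po).Line oRank => C := by
  funext l p q
  simp only [pullKo, lineK, pairK]
  by_cases h : Po.isLower oRank (isoO e l.1) = true
  · rw [dif_pos h]
  · rw [dif_neg h]
    by_cases h' : Po.isLower oRank (isoO e ((pullPo e Po).mate l.1)) = true
    · rw [dif_pos h', hC]
    · exfalso
      have hl : (pullPo e Po).other l.1 = some ((pullPo e Po).mate l.1) := other_eq_some_mate _ l.2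
      have hH : Po.other (isoO e l.1) = some (isoO e ((pullPo e Po).mate l.1)) := by
        rw [pullPo_other, hl, Option.map_some]
      rcases Po.lower_xor oRank oRank_injective hH with ⟨h1, -⟩ | ⟨-, h2⟩
      · exact h h1
      · exact h' h2

/-- **Product external φ-fields relabelled**: p26's `extS` of the fields `ℓ ↦ φ (isoExtS e ℓ)` on `G` is `extS H φ` read through
`e`. [cite: Balaban1983Higgs3, p.419] -/
theorem extS_iso (e : GraphIso G H) (φ : ExtSLeg H → HiggsLattice.ScalarField P 0 N)
    (α : SLeg H.kind → HiggsLattice.Site P 0 × Fin N) :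
    extS G (fun ℓ => φ (isoExtS e ℓ)) (fun ℓ => α (isoS e ℓ.1)) = extS H φ (fun ℓ => α ℓ.1) := by
  unfold extS
  exact Fintype.prod_equiv (isoExtS e) _ _ fun _ => rfl

/-- **Product external A′-fields relabelled.** [cite: Balaban1983Higgs3, p.419] -/
theorem prodExtV_iso (e : GraphIso G H) (Av : ExtVLeg H → HiggsLattice.PBond P 0 → ℝ)
    (β : VLeg H.kind → HiggsLattice.PBond P 0) :
    prodExtV (G := G) (fun ℓ => Av (isoExtV e ℓ)) (fun ℓ => β (isoV e ℓ.1)) = prodExtV Av (fun ℓ => β ℓ.1) := by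
  unfold prodExtV
  exact Fintype.prod_equiv (isoExtV e) _ _ fun _ => rfl

/-- **The (1.12) output field against the unpaired outputs, relabelled** (p26's `extO`, for the transported (1.18) pairing).
[cite: Balaban1983Higgs3, (1.18) p.415] -/
theorem extO_iso (e : GraphIso G H) (Po : OutPairing H) (κ : ℝ) (ψ : HiggsLattice.ScalarField P k N)
    (ο : OLeg H.kind → HiggsLattice.Site P k × Fin N) :
    extO G (pullPo e Po) κ ψ (fun ℓ => ο (isoO e ℓ.1)) = extO H Po κ ψ (fun ℓ => ο ℓ.1) := by
  unfold extO
  exact Fintype.prod_equiv (isoExtO e Po) _ _ fun _ => rfl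

variable [DecidableEq (HiggsLattice.PBond P 0)]

/-- **ISOMORPHIC GRAPHS HAVE THE SAME EXPRESSION E(G, {□(v)}, Φ_ext, A_ext)** (p26's concrete `graphAmp` with the (Higgs)₂,₃ rules
(1.6)–(1.15)): for `e : G ≅ H`, the expression of `G` with the counterterm labels, localizations, (1.18) pairing and line kernels
of `H` read through `e` and relabelled external component functions equals the expression of `H`. [cite: Balaban1983Higgs3, p.420]
[cite: Balaban1983Higgs3, p.415] -/
theorem graphAmp_iso (e : GraphIso G H) (M : Model P N k) (dm2 : Fin H.nV → HiggsLattice.Site P 0 → ℝ)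
    (loc : Fin H.nV → Loc P k) (Po : OutPairing H)
    (Ks : SLine H → HiggsLattice.Site P 0 × Fin N → HiggsLattice.Site P 0 × Fin N → ℝ)
    (Kv : VLine H → HiggsLattice.PBond P 0 → HiggsLattice.PBond P 0 → ℝ)
    (Ko : Po.Line oRank → HiggsLattice.Site P k × Fin N → HiggsLattice.Site P k × Fin N → ℝ)
    (Φ : (ExtSLeg H → HiggsLattice.Site P 0 × Fin N) → ℝ) (A : (ExtVLeg H → HiggsLattice.PBond P 0) → ℝ)
    (Ψ : (Po.Ext → HiggsLattice.Site P k × Fin N) → ℝ)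
    (Φ' : (ExtSLeg G → HiggsLattice.Site P 0 × Fin N) → ℝ) (A' : (ExtVLeg G → HiggsLattice.PBond P 0) → ℝ)
    (Ψ' : ((pullPo e Po).Ext → HiggsLattice.Site P k × Fin N) → ℝ)
    (hΦ : ∀ α : SLeg H.kind → HiggsLattice.Site P 0 × Fin N, Φ' (fun ℓ => α (isoS e ℓ.1)) = Φ (fun ℓ => α ℓ.1))
    (hA : ∀ β : VLeg H.kind → HiggsLattice.PBond P 0, A' (fun ℓ => β (isoV e ℓ.1)) = A (fun ℓ => β ℓ.1))
    (hΨ : ∀ ο : OLeg H.kind → HiggsLattice.Site P k × Fin N, Ψ' (fun ℓ => ο (isoO e ℓ.1)) = Ψ (fun ℓ => ο ℓ.1)) :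
    graphAmp G M (fun i => dm2 (e.toEquiv i)) (fun i => loc (e.toEquiv i)) (pullPo e Po) (pullKs e Ks) (pullKv e Kv)
        (pullKo e Po Ko) Φ' A' Ψ' =
      graphAmp H M dm2 loc Po Ks Kv Ko Φ A Ψ := by
  unfold graphAmp
  rw [← pullRules_rulesOf e M dm2 loc]
  exact amp_iso e _ _ _ _ Po Ks Kv Ko Φ A Ψ Φ' A' Ψ' hΦ hA hΨ

/-- **ISOMORPHIC GRAPHS HAVE THE SAME EXPRESSION, for product external fields** (p26's `extS` / `prodExtV` / `extO`): the external
φ-field of an external leg of `G` is the field of the corresponding leg of `H`. [cite: Balaban1983Higgs3, p.420]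
[cite: Balaban1983Higgs3, p.419] -/
theorem graphAmp_iso_prod (e : GraphIso G H) (M : Model P N k) (dm2 : Fin H.nV → HiggsLattice.Site P 0 → ℝ)
    (loc : Fin H.nV → Loc P k) (Po : OutPairing H)
    (Ks : SLine H → HiggsLattice.Site P 0 × Fin N → HiggsLattice.Site P 0 × Fin N → ℝ)
    (Kv : VLine H → HiggsLattice.PBond P 0 → HiggsLattice.PBond P 0 → ℝ)
    (Ko : Po.Line oRank → HiggsLattice.Site P k × Fin N → HiggsLattice.Site P k × Fin N → ℝ)
    (φ : ExtSLeg H → HiggsLattice.ScalarField P 0 N) (Av : ExtVLeg H → HiggsLattice.PBond P 0 → ℝ) (κ : ℝ)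
    (ψ : HiggsLattice.ScalarField P k N) :
    graphAmp G M (fun i => dm2 (e.toEquiv i)) (fun i => loc (e.toEquiv i)) (pullPo e Po) (pullKs e Ks) (pullKv e Kv)
        (pullKo e Po Ko) (extS G (fun ℓ => φ (isoExtS e ℓ))) (prodExtV (fun ℓ => Av (isoExtV e ℓ)))
        (extO G (pullPo e Po) κ ψ) =
      graphAmp H M dm2 loc Po Ks Kv Ko (extS H φ) (prodExtV Av) (extO H Po κ ψ) :=
  graphAmp_iso e M dm2 loc Po Ks Kv Ko _ _ _ _ _ _ (extS_iso e φ) (prodExtV_iso e Av) (extO_iso e Po κ ψ)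

end Concrete

/-! ## §5 The amputated two-point kernel of a dressed insertion is an isomorphism invariant -/

section Dressed

variable {nbar : ℕ} {T T' : TwoLegGraph nbar}

/-- **The in-leg of the channel goes to the in-leg** (as a φ′-leg: p37's `sIn`). [cite: Balaban1983Higgs3, (1.21) p.416] -/
theorem isoS_sIn (e : TwoLegGraphIso T T') : isoS e.toGraphIso (sIn T) = sIn T' :=
  sLeg_toLeg_injective (by rw [toLeg_isoS, toLeg_sleg, e.legMap_legIn, toLeg_sleg])

/-- **The out-leg of the channel goes to the out-leg.** [cite: Balaban1983Higgs3, (1.21) p.416] -/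
theorem isoS_sOut (e : TwoLegGraphIso T T') : isoS e.toGraphIso (sOut T) = sOut T' :=
  sLeg_toLeg_injective (by rw [toLeg_isoS, toLeg_sleg, e.legMap_legOut, toLeg_sleg])

/-- kernel: the in-leg as an external φ′-leg goes to the in-leg. [cite: Balaban1983Higgs3, (1.21) p.416] -/
theorem isoExtS_extIn (e : TwoLegGraphIso T T') : isoExtS e.toGraphIso (extIn T) = extIn T' :=
  Subtype.ext (isoS_sIn e)

/-- kernel: the out-leg as an external φ′-leg goes to the out-leg. [cite: Balaban1983Higgs3, (1.21) p.416] -/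
theorem isoExtS_extOut (e : TwoLegGraphIso T T') : isoExtS e.toGraphIso (extOut T) = extOut T' :=
  Subtype.ext (isoS_sOut e)

/-- **The non-channel external φ′-legs of isomorphic insertions correspond** (p37's `Rest`). [cite: Balaban1983Higgs3, (1.21) p.416] -/
def isoRest (e : TwoLegGraphIso T T') : Rest T ≃ Rest T' :=
  (isoExtS e.toGraphIso).subtypeEquiv fun x => by
    change (x.1 ≠ sIn T ∧ x.1 ≠ sOut T) ↔ (isoS e.toGraphIso x.1 ≠ sIn T' ∧ isoS e.toGraphIso x.1 ≠ sOut T')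
    rw [← isoS_sIn e, ← isoS_sOut e, (isoS e.toGraphIso).injective.ne_iff, (isoS e.toGraphIso).injective.ne_iff]

/-- kernel: the underlying external leg of the preimage non-channel leg. [cite: Balaban1983Higgs3, (1.21) p.416] -/
@[simp] theorem isoRest_symm_apply_val (e : TwoLegGraphIso T T') (y : Rest T') :
    ((isoRest e).symm y).1 = (isoExtS e.toGraphIso).symm y.1 := rfl

/-- kernel: the underlying external leg of the image non-channel leg. [cite: Balaban1983Higgs3, (1.21) p.416] -/
@[simp] theorem isoRest_apply_val (e : TwoLegGraphIso T T') (x : Rest T) :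
    (isoRest e x).1 = isoExtS e.toGraphIso x.1 := rfl

variable {SF VF OF IS IV IO : Type*}

/-- **A DRESSING READ THROUGH AN ISOMORPHISM of two-leg insertions**: the vertex rules, the (1.18) output pairing, the line and
output-pair kernels and the external data of the non-channel legs of `T'`, read on `T` along `e : T ≅ T'`.
[cite: Balaban1983Higgs3, p.420] [cite: Balaban1983Higgs3, (1.21) p.416] -/
def pullDressing (e : TwoLegGraphIso T T') (D : Dressing SF VF OF IS IV IO T') : Dressing SF VF OF IS IV IO T where
  V := pullRules e.toGraphIso D.V
  Po := pullPo e.toGraphIso D.Po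
  Ks := pullKs e.toGraphIso D.Ks
  Kv := pullKv e.toGraphIso D.Kv
  Ko := pullKo e.toGraphIso D.Po D.Ko
  F := fun γ => D.F fun y => γ ((isoRest e).symm y)
  A := pullExtV e.toGraphIso D.A
  Ψ := pullExtO e.toGraphIso D.Po D.Ψ

variable [Fintype IS] [Fintype IV] [Fintype IO] (bS : IS → SF) (bV : IV → VF) (bO : IO → OF)

/-- **The expression of a dressed insertion is an isomorphism invariant**: for an external function `Φ'` of all φ′-legs of `T`
that is `Φ` relabelled, `(pullDressing e D).legAmp Φ' = D.legAmp Φ`. [cite: Balaban1983Higgs3, p.420] -/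
theorem legAmp_pull (e : TwoLegGraphIso T T') (D : Dressing SF VF OF IS IV IO T') (Φ : (ExtSLeg T'.G → IS) → ℝ)
    (Φ' : (ExtSLeg T.G → IS) → ℝ) (hΦ : ∀ α : SLeg T'.G.kind → IS, Φ' (fun ℓ => α (isoS e.toGraphIso ℓ.1)) = Φ (fun ℓ => α ℓ.1)) :
    (pullDressing e D).legAmp bS bV bO Φ' = D.legAmp bS bV bO Φ := by
  dsimp only [Dressing.legAmp, pullDressing]
  exact amp_iso e.toGraphIso D.V bS bV bO D.Po D.Ks D.Kv D.Ko Φ D.A D.Ψ Φ' _ _ hΦ (pullExtV_apply e.toGraphIso D.A)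
    (pullExtO_apply e.toGraphIso D.Po D.Ψ)

variable [DecidableEq IS]

/-- **THE AMPUTATED TWO-POINT KERNEL `K_T(p,q) = E(T)[in ↦ δ_p, out ↦ δ_q]` IS AN ISOMORPHISM INVARIANT OF DRESSED INSERTIONS**:
for `e : T ≅ T'` and a dressing `D` of `T'`, the kernel of `T` dressed by `D` read through `e` is the kernel of `T'` — the Σ's of
(1.21), *"given by amputated, one-particle-irreducible graphs"*, are functions of the graph *"in the usual sense"* (p. 415), not of
its labelling. [cite: Balaban1983Higgs3, (1.21) p.416] [cite: Balaban1983Higgs3, p.415] -/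
theorem kernel_pull (e : TwoLegGraphIso T T') (D : Dressing SF VF OF IS IV IO T') :
    (pullDressing e D).kernel bS bV bO = D.kernel bS bV bO := by
  ext p q
  simp only [Dressing.kernel, Matrix.of_apply]
  refine legAmp_pull bS bV bO e D _ _ fun α => ?_
  show (if α (isoS e.toGraphIso (sIn T)) = p then (1 : ℝ) else 0) *
        (if α (isoS e.toGraphIso (sOut T)) = q then (1 : ℝ) else 0) *
        D.F (fun y => α (isoS e.toGraphIso ((isoS e.toGraphIso).symm y.1.1))) =
      (if α (sIn T') = p then (1 : ℝ) else 0) * (if α (sOut T') = q then (1 : ℝ) else 0) * D.F (fun y => α y.1.1)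
  simp only [Equiv.apply_symm_apply, isoS_sIn, isoS_sOut]

end Dressed

end

end Literature.MathematicalPhysics.QuantumFieldTheory.Balaban1983to89.B3GraphIsoAmplitude
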